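import Mathlib
import Summits.NavierStokesRegularity.NavierStokesRegularity.Theorems.FilamentSkeletonRssAnalyticStripLiaSymbolNumericsDefs

/-!
# Clause 13-J/13-R, brick B4 (NEGATIVE WINDOW, certified numerics) — DEFINITIONS: the cell checker `cellOKNeg`/`cellsOKNeg` and the `p`-grid

Route `FilamentSkeletonRss`, ∃-side clause 13 (`Clause13RNearStraightL` stmt-NavierStokesRegularity-23612; typing-agnostic); design
`filament-plan/DESIGN-28296-model-gluing-g16.md` §4 n1a.  Statement-only file (definitions; no theorem), companion of
`…AnalyticStripLiaSymbolNumericsDefs` (lane g12): the window N of the model gluing needs `𝔖(x) ≤ −κ_N`, i.e. `Φ(p) ≤ −κ_N` with `Φ = 1 − C − 2pE`,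
`p = x²/4`; since `C`, `E` are antitone, on a `p`-cell `[a,b]` it suffices that `1 − lowerC(b) − 2a·lowerE(b) ≤ −κ` with the lower bracket sums of the
`t`-grid of record.  The soundness proofs, the kernel-replayed certificate (`κ_N = 1/64` on `p ∈ [0.015, 0.226]`, i.e. `x ∈ [1/4, 19/20]`) and the
real-variable statement are `…Clause13LiaSymbolNegWindow`.
Lane ns-filament-19175-p1 g16; `--supports stmt-NavierStokesRegularity-23612 --as helper`.
HONEST FRAMING: certified numerics for one explicit real integral, serving a HYPOTHETICAL filament-skeleton line on the NEGATIVE side of a MODEL route;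
nothing here bears on Navier–Stokes regularity or blow-up.
-/

set_option linter.dupNamespace false

noncomputable section

namespace Summit.NavierStokesRegularity.NavierStokesRegularity.Theorems.AnalyticStripLiaSymbol

namespace Numerics

/-- One `p`-cell `[a, b]` of the negative window: `Φ ≤ −κ` via `1 − lowerC(b) − 2a·lowerE(b) ≤ −κ` (`C`, `E` antitone). -/
def cellOKNeg (κ : ℚ) (l : List (ℚ × ℚ × ℚ)) (a b : ℚ) : Bool :=
  decide (0 < a) && decide (a ≤ b) && decide (1 - lowerC b l - 2 * a * lowerE b l ≤ -κ)

/-- Check all consecutive cells of a `p`-grid. -/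
def cellsOKNeg (κ : ℚ) (l : List (ℚ × ℚ × ℚ)) : List ℚ → Bool
  | a :: b :: rest => cellOKNeg κ l a b && cellsOKNeg κ l (b :: rest)
  | _ => true

/-- The `p`-grid tail after the head `15/1000`: step `10⁻³` up to `0.1`, then `2·10⁻³` up to `0.226` (148 cells). -/
def pgridNegTail : List ℚ :=
  ((List.range 84).map fun j => ((16 : ℚ) + j) / 1000) ++ ((List.range 64).map fun j => ((100 : ℚ) + 2 * j) / 1000)

end Numerics

end Summit.NavierStokesRegularity.NavierStokesRegularity.Theorems.AnalyticStripLiaSymbol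

end
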